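import Mathlib
import HarnessLib

set_option linter.dupNamespace false -- mandated namespace of this single-conjunct summit

/-!
# Eigen-parameters for a derivation of multiplicative type on a regular local ring

Let `R` be a regular local ring of prime characteristic `p` and `D : R → R` a derivation with
`D^[p] = D` (the infinitesimal form of a `μ_p`-action) preserving the maximal ideal `𝔪`.  Then
`𝔪` is generated by a regular system of parameters `s₁, …, sₙ` (`n = dim R`) consisting of
`D`-eigenvectors, `D sᵢ = aᵢ sᵢ`, with eigenvalues `aᵢ ∈ {0, …, p - 1} ⊆ ℕ`.

Proof.  Since `p = 0` in `R`, `D` is `𝔽ₚ`-linear and `T ^ p - T = ∏_{a ∈ 𝔽ₚ} (T - a)` kills `D`;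
Lagrange interpolation in `D` (the polynomials `ℓ_a(D)`, `a ∈ 𝔽ₚ`) splits every `m ∈ 𝔪` as a sum
of `D`-eigenvectors, each again in `𝔪` because polynomials in `D` preserve `𝔪`.  Hence the
eigenvectors lying in `𝔪` span `𝔪`, so their images span the cotangent space `𝔪 / 𝔪²`; a basis
extracted from these images lifts (Nakayama) to a generating family of `𝔪` made of eigenvectors,
of cardinality `dim_κ 𝔪 / 𝔪² = dim R` by regularity.
-/

namespace Summit.ResolutionOfSingularities.ResolutionOfSingularities.Theorems.Picover.EigenParameters

open IsLocalRing Polynomial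

/-- Over `𝔽ₚ = ZMod p`, the nodal polynomial of all of `𝔽ₚ` is `∏_{a ∈ 𝔽ₚ} (X - a) = X ^ p - X`. -/
private theorem nodal_univ_eq (p : ℕ) [Fact p.Prime] :
    Lagrange.nodal (Finset.univ : Finset (ZMod p)) (fun x => x) = X ^ p - X := by
  have hp : 1 < p := (Fact.out : p.Prime).one_lt
  have hroots : (X ^ p - X : (ZMod p)[X]).roots = Finset.univ.val := by
    have h := FiniteField.roots_X_pow_card_sub_X (ZMod p)
    rwa [ZMod.card p] at h
  have hdeg := FiniteField.X_pow_card_sub_X_natDegree_eq (ZMod p) hp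
  have hmonic : (X ^ p - X : (ZMod p)[X]).Monic :=
    Polynomial.monic_X_pow_sub (by rw [degree_X]; exact_mod_cast hp)
  have h := Polynomial.prod_multiset_X_sub_C_of_monic_of_roots_card_eq hmonic
    (by rw [hroots, hdeg, ← Finset.card_def, Finset.card_univ, ZMod.card p])
  rw [hroots] at h
  rw [Lagrange.nodal_eq, Finset.prod_eq_multiset_prod]
  exact h

/-- **Eigen-decomposition.**  Let `R` have prime characteristic `p`, let `D` be a derivation of
`R` with `D^[p] = D`, and let `I` be an ideal with `D(I) ⊆ I`.  Then every `m ∈ I` is a (finite)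
sum `m = ∑_{a ∈ 𝔽ₚ} c_a` of `D`-eigenvectors `c_a ∈ I`, `D c_a = a • c_a`; here `c_a = ℓ_a(D) m`
for the Lagrange interpolation polynomials `ℓ_a` at the nodes `𝔽ₚ`. -/
private theorem exists_eigen_sum {R : Type*} [CommRing R] (p : ℕ) [Fact p.Prime] [CharP R p]
    (D : Derivation ℤ R R) (hDp : ∀ r, (⇑D)^[p] r = D r) (I : Ideal R)
    (hDI : ∀ r ∈ I, D r ∈ I) (m : R) (hm : m ∈ I) :
    ∃ c : ZMod p → R, (∀ a, c a ∈ I) ∧ (∀ a, D (c a) = (a.val : R) * c a) ∧ m = ∑ a, c a := by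
  letI : Algebra (ZMod p) R := ZMod.algebra R p
  let L : R →ₗ[ZMod p] R := D.toLinearMap.toAddMonoidHom.toZModLinearMap p
  have hL : ∀ r, L r = D r := fun r => rfl
  have hLD : (⇑L : R → R) = ⇑D := rfl
  have hsmul : ∀ (a : ZMod p) (r : R), a • r = (a.val : R) * r := fun a r => by
    change (ZMod.cast a : R) * r = _
    rw [ZMod.cast_eq_val]
  -- polynomials in `L` preserve `I`
  have hpres : ∀ q : (ZMod p)[X], ∀ r ∈ I, aeval L q r ∈ I := by
    intro q
    induction q using Polynomial.induction_on with
    | C c =>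
      intro r hr
      rw [aeval_C, Module.algebraMap_end_apply, hsmul]
      exact I.mul_mem_left _ hr
    | add q₁ q₂ h₁ h₂ =>
      intro r hr
      rw [map_add, LinearMap.add_apply]
      exact I.add_mem (h₁ r hr) (h₂ r hr)
    | monomial k c h =>
      intro r hr
      rw [pow_succ, ← mul_assoc, map_mul, Module.End.mul_apply, aeval_X, hL]
      exact h (D r) (hDI r hr)
  -- `X ^ p - X` annihilates `L`
  have hann : aeval L (X ^ p - X : (ZMod p)[X]) = 0 := by
    ext r
    rw [map_sub, map_pow, aeval_X, LinearMap.sub_apply, Module.End.pow_apply,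
      LinearMap.zero_apply, hLD, hDp r, sub_self]
  refine ⟨fun a => aeval L (Lagrange.basis Finset.univ (fun x : ZMod p => x) a) m,
    fun a => hpres _ m hm, fun a => ?_, ?_⟩
  · -- eigenvector equation: `(X - a) ℓ_a = w_a (X ^ p - X)` kills `L`
    have ha : a ∈ (Finset.univ : Finset (ZMod p)) := Finset.mem_univ a
    have key : (X - C a) * Lagrange.basis Finset.univ (fun x : ZMod p => x) a =
        C (Lagrange.nodalWeight Finset.univ (fun x : ZMod p => x) a) * (X ^ p - X) := by
      rw [Lagrange.basis_eq_prod_sub_inv_mul_nodal_div ha,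
        ← Lagrange.nodal_erase_eq_nodal_div ha, mul_left_comm,
        ← Lagrange.nodal_eq_mul_nodal_erase (v := fun x : ZMod p => x) ha, nodal_univ_eq]
    have h1 : aeval L ((X - C a) * Lagrange.basis Finset.univ (fun x : ZMod p => x) a) = 0 := by
      rw [key, map_mul, hann, mul_zero]
    have h2 := LinearMap.congr_fun h1 m
    rw [map_mul, Module.End.mul_apply, map_sub, aeval_X, aeval_C, LinearMap.sub_apply,
      Module.algebraMap_end_apply, LinearMap.zero_apply, sub_eq_zero, hL, hsmul] at h2
    exact h2
  · -- the components sum to `m`: `∑_a ℓ_a = 1`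
    have h1 : ∑ a ∈ (Finset.univ : Finset (ZMod p)),
        Lagrange.basis Finset.univ (fun x : ZMod p => x) a = 1 :=
      Lagrange.sum_basis (fun _ _ _ _ h => h) Finset.univ_nonempty
    have h2 := LinearMap.congr_fun (congrArg (aeval L) h1) m
    rw [map_sum, LinearMap.sum_apply, map_one, Module.End.one_apply] at h2
    exact h2.symm

/-- **Linearisation of a `μ_p`-type derivation on a regular local ring.**  If `R` is a regular
local ring of characteristic `p`, `D` a derivation of `R` with `D^[p] = D` and `D(𝔪) ⊆ 𝔪`, then
`𝔪` is generated by `n = dim R` eigenvectors of `D` with eigenvalues in `{0, …, p-1} ⊆ ℕ`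
(a regular system of parameters of `D`-eigenvectors). -/
theorem exists_eigen_regularParameters : ∀ {R : Type} [CommRing R] [IsRegularLocalRing R] (p : ℕ) [Fact p.Prime] [CharP R p] (D : Derivation ℤ R R), (∀ r, (⇑D)^[p] r = D r) → (∀ r ∈ IsLocalRing.maximalIdeal R, D r ∈ IsLocalRing.maximalIdeal R) → ∃ (n : ℕ) (s : Fin n → R) (a : Fin n → ℕ), Ideal.span (Set.range s) = IsLocalRing.maximalIdeal R ∧ (n : WithBot ℕ∞) = ringKrullDim R ∧ ∀ i, D (s i) = (a i : R) * s i := by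
  intro R _ _ p _ _ D hDp hDm
  -- the `D`-eigenvectors (with eigenvalue in `ℕ`) lying in `𝔪`
  let H : Set (maximalIdeal R) := {x | ∃ a : ℕ, D (x : R) = (a : R) * (x : R)}
  -- Step 1: they span `𝔪`
  have hspanH : Submodule.span R H = ⊤ := by
    refine eq_top_iff.mpr fun x _ => ?_
    obtain ⟨c, hcI, hcD, hsum⟩ := exists_eigen_sum p D hDp (maximalIdeal R) hDm x.1 x.2
    have hx : x = ∑ a, (⟨c a, hcI a⟩ : maximalIdeal R) := by
      apply Subtype.ext
      rw [Submodule.coe_sum]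
      exact hsum
    rw [hx]
    exact Submodule.sum_mem _ fun a _ => Submodule.subset_span ⟨a.val, hcD a⟩
  -- Step 2: hence their images span the cotangent space; extract a basis from them
  have hspanT : Submodule.span (ResidueField R) ((maximalIdeal R).toCotangent '' H) = ⊤ :=
    CotangentSpace.span_image_eq_top_iff.mpr hspanH
  let b := Module.Basis.ofSpan (le_of_eq hspanT.symm)
  have hbH : ∀ j, ∃ x ∈ H, (maximalIdeal R).toCotangent x = b j := fun j =>
    Module.Basis.ofSpan_subset (le_of_eq hspanT.symm) ⟨j, rfl⟩
  choose t htH htb using hbH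
  haveI := Module.Finite.finite_basis b
  letI := Fintype.ofFinite ((linearIndepOn_empty (ResidueField R) id).extend
    (Set.empty_subset ((maximalIdeal R).toCotangent '' H)))
  set n := Fintype.card ((linearIndepOn_empty (ResidueField R) id).extend
    (Set.empty_subset ((maximalIdeal R).toCotangent '' H))) with hn
  let e := Fintype.equivFin ((linearIndepOn_empty (ResidueField R) id).extend
    (Set.empty_subset ((maximalIdeal R).toCotangent '' H)))
  -- the regular system of parameters
  let s' : Fin n → maximalIdeal R := fun i => t (e.symm i)
  have hex : ∀ i : Fin n, ∃ a : ℕ, D (s' i : R) = (a : R) * (s' i : R) := fun i => htH (e.symm i)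
  choose a ha using hex
  refine ⟨n, fun i => (s' i : R), a, ?_, ?_, ha⟩
  · -- Step 3 (Nakayama): the lifts generate `𝔪`
    have hrange : (maximalIdeal R).toCotangent '' Set.range s' = Set.range b := by
      rw [← Set.range_comp]
      have : (maximalIdeal R).toCotangent ∘ s' = b ∘ e.symm := funext fun i => htb (e.symm i)
      rw [this, e.symm.surjective.range_comp]
    have hspan' : Submodule.span R (Set.range s') = ⊤ := by
      rw [← CotangentSpace.span_image_eq_top_iff, hrange]
      exact b.span_eq
    have hset : Set.range (fun i => (s' i : R)) = (maximalIdeal R).subtype '' Set.range s' := by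
      rw [← Set.range_comp]
      rfl
    rw [hset, Ideal.span, Submodule.span_image, hspan', Submodule.map_top, Submodule.range_subtype]
  · -- Step 4: `n = dim_κ 𝔪/𝔪² = dim R` by regularity
    have h := (IsRegularLocalRing.iff_finrank_cotangentSpace R).mp ‹_›
    rwa [Module.finrank_eq_card_basis b] at h

end Summit.ResolutionOfSingularities.ResolutionOfSingularities.Theorems.Picover.EigenParameters
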